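import Literature.IUT.HodgeArakelov.MonoThetaProjectiveBridgeEtThFacts
import Literature.AnabelianGeometry.EtaleTheta.SettingModelChiGroupLevelHolds
import Literature.AnabelianGeometry.EtaleTheta.SettingModelChiTheta
import Literature.AnabelianGeometry.EtaleTheta.SettingModelChiKummerData
import HarnessLib

/-!
# [IUTchII] Prop. 1.5 (i), (i)′, (ii) for the [EtTh] model family AT THE RECORD MODEL `ThetaSetting.modelχ p`:
# temp-slimness of `Π^tp_X`, openness of `Π^tp_X ↠ G_K` and the §1 origin clauses are THEOREMS there
# (proof-only capstone; DAG nodes IUTchII:Prop1.5(i), IUTchII:Prop1.5(ii))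

S. Mochizuki, *Inter-universal Teichmüller theory II*, kurims manuscript (Dec. 2020), Prop. 1.5 (i), (ii) p. 29
[claim: Mochizuki2012, status: disputed] (IUTchII §1 Prop 1.5, kurims p.29): "(i) … Such a projective system is
uniquely determined, up to isomorphism, by `X̲̲_k` [cf. … the discrete rigidity property of [EtTh], Corollary
2.19, (ii)]. (ii) The transition morphisms … are all isomorphisms. Moreover, any isomorphism … lifts …
[cf. [EtTh], Corollary 2.18, (iv)]."; S. Mochizuki, *The étale theta function …*, Publ. RIMS **45** (2009)
[EtTh], Cor. 2.18 (iv) pp. 61–63, Cor. 2.19 (ii) p. 64 (PRIMS PDF pages) [cite: MochizukiEtTh2009, Cor 2.19(ii) p.64];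
S. Mochizuki, *Semi-graphs of anabelioids* [SemiAnbd], Publ. RIMS **42** (2006), Ex. 3.10 p. 45 («both `Δ` and `Π`
are temp-slim») [cite: MochizukiSemiAnbd2006, Ex 3.10 p.45].  Cell `abc-iut`, block F, seat abc-iut-f-150 (gen 2);
PROOF-ONLY: no definition, no instance, no new named fact; nothing of another seat edited or restated (the
`Normal` / `IsMulCommutative` instances on `(modelχ p).Δ_Θ` needed to state the root cocycle `f` are abc-iut-w5-d171's,
imported from `SettingModelChiKummerData.lean`).

STATE OF RECORD.  abc-iut-L2-t10's `MonoThetaProjectiveBridgeEtThFacts.lean` (over abc-iut-w4-d030 / w4-d038's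
[IUTchII] §1 bridge `modelFamily`, `reductions`, `modelSystem`) proves [IUTchII] Prop. 1.5 (i)′, (ii) and (i) in
the printed form for the model family of `X̲̲_K` built from ANY [EtTh] §1 theta setting `D`, modulo ONE binder
list = the FACT-LIST inputs of abc-iut-L2-d1's [EtTh] Cor. 2.19 (ii) model discharge: Prop. 1.5 (ii), (iii) of
[EtTh] §1 (`h15ii`, `h15`), cusp labels `L`, temp-slimness of `Π^tp_X` (`hslimX : IsSlimGroup D.PiTemp`),
openness of `Π^tp_X → G_K` (`haugOpen`), Cor. 2.18 (i) at every chain level (`h218i`), constant multiple rigidity in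
tower form (`h219iii`), and the §1 origin hypotheses `IsEtThOrigin`, `hYcl`.

THIS FILE.  At the record model `D := ThetaSetting.modelχ p` of the R78 cluster (abc-iut-L2-t1;
`toTemperedCurve := curveχ p`, `Π^tp_X = Γ ⋊_χ G_{ℚ_p}`, `Γ = F̂₂ ×_Ẑ ℤ`) FOUR of these binders are THEOREMS —
`hslimX` (abc-iut-w5-d111's `isSlimGroup_piTemp_curveχ`), `haugOpen` (abc-iut-L2-t1's `isOpenMap_aug_modelχ`),
`IsEtThOrigin` (`modelχ_isEtThOrigin`), `hYcl` (`hYcl_modelχ`) — so for EVERY étale-theta datum `E` over `modelχ p`,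
every `X̲̲`-choice `C`, every compatible cyclotome tower `τ` over a cofinal chain `Es ∋ 1` and every root cocycle
`f`, [IUTchII] Prop. 1.5 (i)′ (`prop15_i'_of_cyclotomeTower_modelχ`), (ii) (`transitionsAreIsos_modelSystem_modelχ`),
(i) in the printed form (`prop15_i_modelSystem_modelχ`, `_symm`) and the one-list summary (`prop15_modelSystem_modelχ`)
hold modulo the RESIDUAL list {Prop. 1.5 (ii), (iii) of [EtTh] §1, `L`, Cor. 2.18 (i) at the chain levels,
`ThetaEnvTower.Cor219_iii`} (and the bridge's standing side conditions `hl`, `hp2`, `hpl`, `hζ`; at `modelχ`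
`K = ℚ_p`, so `hζ` — a primitive `4l`-th root of unity in `K` — restricts `p` to `p ≡ 1 (mod 4l)`).

HONEST LABEL: `modelχ` is a SEMI-SYNTHETIC model of the typed [EtTh] §1 interface (not the tempered `π₁` of a
curve): joint-satisfiability evidence for the interface / origin binders of the [IUTchII] Prop. 1.5 model
discharge, and the kernel record that at the inhabitant of record those four binders are not assumptions;
the [IUTchII] claim key `Mochizuki2012` is DISPUTED (D-0012) and nothing of it is asserted; nothing of [EtTh] /
[SemiAnbd] (refereed) is asserted; no side is taken on [IUTchIII] Cor. 3.12; typed ≠ proved.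
-/

noncomputable section

namespace Literature.IUT.HodgeArakelov

open Literature.AnabelianGeometry.EtaleTheta Literature.AnabelianGeometry.SemiGraphs
open scoped Literature.AnabelianGeometry.EtaleTheta

namespace EtaleLevels

variable (p : ℕ) [Fact p.Prime]
  {E : (ThetaSetting.modelχ p).EtaleThetaData} {l : ℕ} (C : E.DoubleUnderline l)
  (hC : (ThetaSetting.modelχ p).Compat) (hS : (ThetaSetting.modelχ p).Sec2Hyps)
  (hl : l.Prime) (hp2 : p ≠ 2) (hpl : p ≠ l) (hζ : ∃ ζ : (ThetaSetting.modelχ p).K, IsPrimitiveRoot ζ (4 * l))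
  {Es : Set ℕ+} (τ : (ThetaSetting.modelχ p).CyclotomeTower l Es)
  (f : contCocycles (ThetaSetting.modelχ p).toTheta (ThetaSetting.modelχ p).DeltaTheta C.GtpYdduu)
  (hf : f ∈ C.rootCocycles hC)

/-! ## Prop. 1.5 (i)′ at the record model -/

/-- **[IUTchII] Prop. 1.5 (i)′ over `ℕ≥1` for the model family AT THE RECORD MODEL `modelχ p`**: any two projective
systems of mono-theta environments over the model family of `X̲̲` (levels `τ.modAll M`, `M ∈ ℕ≥1`) whose transitions
are morphisms of mono-theta environments are compatibly isomorphic — abc-iut-L2-t10's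
`prop15_i'_of_cyclotomeTower_of_facts` with `hslimX`, `haugOpen`, `IsEtThOrigin`, `hYcl` SUPPLIED by the record
model's theorems; residual inputs: Prop. 1.5 (ii), (iii) of [EtTh] §1, the cusp labels, Cor. 2.18 (i) at the chain
levels, `ThetaEnvTower.Cor219_iii`. [claim: Mochizuki2012, status: disputed] (IUTchII §1 Prop 1.5 (i), kurims p.29)
[cite: MochizukiEtTh2009, Cor 2.19(ii) p.64] -/
theorem prop15_i'_of_cyclotomeTower_modelχ
    (h15 : Literature.AnabelianGeometry.EtaleTheta.ThetaSetting.Prop15iii E hC)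
    (h15ii : Literature.AnabelianGeometry.EtaleTheta.ThetaSetting.Prop15ii E.toKummerData hC)
    (L : C.CuspLabels)
    (h218i : ∀ e : Es, (C.rigidData (τ.mod e) hC hS h15 L).Cor218_i)
    (h219iii : (C.thetaEnvTower τ hC hS).Cor219_iii)
    (A B : MonoThetaProjSystem (modelFamily C hC hS hl hp2 hpl hζ τ.modAll f hf)) :
    Literature.IUT.HodgeArakelov.Prop15_i'
      (reductions C hC hS hl hp2 hpl hζ τ.modAll f hf τ.red_modAll (SettingModel.isSlimGroup_piTemp_curveχ p))
      A B :=
  prop15_i'_of_cyclotomeTower_of_facts C hC hS hl hp2 hpl hζ τ f hf (SettingModel.isSlimGroup_piTemp_curveχ p)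
    (SettingModel.isOpenMap_aug_modelχ p) h15 h15ii L h218i h219iii (ThetaSetting.modelχ_isEtThOrigin p)
    (SettingModel.hYcl_modelχ p) A B

/-! ## Prop. 1.5 (ii) for the natural system at the record model -/

/-- **[IUTchII] Prop. 1.5 (ii) for the NATURAL system of `X̲̲` AT THE RECORD MODEL**: the transitions of the natural
projective system of model mono-theta environments over `modelχ p` induce isomorphisms on `Π_X(–)`, and every such
isomorphism lifts — abc-iut-L2-t10's `transitionsAreIsos_modelSystem_of_origin` with `IsEtThOrigin`, `hYcl`
SUPPLIED (the system's input "`(l·Δ_Θ)(M) ≅ Ẑ`" being abc-iut-L2-d1's theorem at an origin); residual inputs: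
Prop. 1.5 (ii), (iii), `L`, Cor. 2.18 (i) at the chain levels, `ThetaEnvTower.Cor219_iii`.
[claim: Mochizuki2012, status: disputed] (IUTchII §1 Prop 1.5 (ii), kurims p.29) [cite: MochizukiEtTh2009, Cor 2.18(iv) p.61] -/
theorem transitionsAreIsos_modelSystem_modelχ
    (h15 : Literature.AnabelianGeometry.EtaleTheta.ThetaSetting.Prop15iii E hC)
    (h15ii : Literature.AnabelianGeometry.EtaleTheta.ThetaSetting.Prop15ii E.toKummerData hC)
    (L : C.CuspLabels)
    (h218i : ∀ e : Es, (C.rigidData (τ.mod e) hC hS h15 L).Cor218_i)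
    (h219iii : (C.thetaEnvTower τ hC hS).Cor219_iii) :
    (modelSystem C hC hS hl hp2 hpl hζ τ.modAll f hf τ.red_modAll h15 L (fun M =>
      ModelCyclotomes.nonempty_lDeltaQuot_rigidData_mulEquiv_zHat C (τ.modAll M) hC hS h15 L
        (ThetaSetting.modelχ_isEtThOrigin p) (SettingModel.hYcl_modelχ p) hl.ne_zero)).transitionsAreIsos :=
  transitionsAreIsos_modelSystem_of_origin C hC hS hl hp2 hpl hζ τ f hf h15 h15ii L h218i h219iii
    (ThetaSetting.modelχ_isEtThOrigin p) (SettingModel.hYcl_modelχ p)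

/-! ## Prop. 1.5 (i) as printed, at the record model -/

/-- **[IUTchII] Prop. 1.5 (i) in the PRINTED form AT THE RECORD MODEL** ("uniquely determined, up to isomorphism,
by `X̲̲_k`"): every projective system `B` of mono-theta environments over the model family of `X̲̲` over `modelχ p`
whose transitions are morphisms of mono-theta environments is isomorphic to the NATURAL system —
abc-iut-L2-t10's `prop15_i_modelSystem_of_origin` with `hslimX`, `haugOpen`, `IsEtThOrigin`, `hYcl` SUPPLIED;
residual inputs: Prop. 1.5 (ii), (iii), `L`, Cor. 2.18 (i) at the chain levels, `ThetaEnvTower.Cor219_iii`.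
[claim: Mochizuki2012, status: disputed] (IUTchII §1 Prop 1.5 (i), kurims p.29) [cite: MochizukiEtTh2009, Cor 2.19(ii) p.64] -/
theorem prop15_i_modelSystem_modelχ
    (h15 : Literature.AnabelianGeometry.EtaleTheta.ThetaSetting.Prop15iii E hC)
    (h15ii : Literature.AnabelianGeometry.EtaleTheta.ThetaSetting.Prop15ii E.toKummerData hC)
    (L : C.CuspLabels)
    (h218i : ∀ e : Es, (C.rigidData (τ.mod e) hC hS h15 L).Cor218_i)
    (h219iii : (C.thetaEnvTower τ hC hS).Cor219_iii)
    (B : MonoThetaProjSystem (modelFamily C hC hS hl hp2 hpl hζ τ.modAll f hf))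
    (hB : B.IsMonoThetaCompatible
      (reductions C hC hS hl hp2 hpl hζ τ.modAll f hf τ.red_modAll (SettingModel.isSlimGroup_piTemp_curveχ p))) :
    Prop15_i (modelSystem C hC hS hl hp2 hpl hζ τ.modAll f hf τ.red_modAll h15 L (fun M =>
      ModelCyclotomes.nonempty_lDeltaQuot_rigidData_mulEquiv_zHat C (τ.modAll M) hC hS h15 L
        (ThetaSetting.modelχ_isEtThOrigin p) (SettingModel.hYcl_modelχ p) hl.ne_zero)) B :=
  prop15_i_modelSystem_of_origin C hC hS hl hp2 hpl hζ τ f hf (SettingModel.isSlimGroup_piTemp_curveχ p)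
    (SettingModel.isOpenMap_aug_modelχ p) h15 h15ii L h218i h219iii (ThetaSetting.modelχ_isEtThOrigin p)
    (SettingModel.hYcl_modelχ p) B hB

/-- `prop15_i_modelSystem_modelχ` with the natural system on the RIGHT, the system's input "`(l·Δ_Θ)(M) ≅ Ẑ`" kept
as a binder `hZ` (abc-iut-L2-t10's `prop15_i_modelSystem_of_facts_symm` at the record model; `hslimX`, `haugOpen`,
`IsEtThOrigin`, `hYcl` SUPPLIED). [claim: Mochizuki2012, status: disputed] (IUTchII §1 Prop 1.5 (i), kurims p.29)
[cite: MochizukiEtTh2009, Cor 2.19(ii) p.64] -/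
theorem prop15_i_modelSystem_modelχ_symm
    (h15 : Literature.AnabelianGeometry.EtaleTheta.ThetaSetting.Prop15iii E hC)
    (h15ii : Literature.AnabelianGeometry.EtaleTheta.ThetaSetting.Prop15ii E.toKummerData hC)
    (L : C.CuspLabels)
    (hZ : ∀ M : ℕ+, Nonempty (ModelCyclotomes.lDeltaQuot (C.rigidData (τ.modAll M) hC hS h15 L) ≃*
      Literature.IUT.HodgeTheaters.ZHat))
    (h218i : ∀ e : Es, (C.rigidData (τ.mod e) hC hS h15 L).Cor218_i)
    (h219iii : (C.thetaEnvTower τ hC hS).Cor219_iii)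
    (B : MonoThetaProjSystem (modelFamily C hC hS hl hp2 hpl hζ τ.modAll f hf))
    (hB : B.IsMonoThetaCompatible
      (reductions C hC hS hl hp2 hpl hζ τ.modAll f hf τ.red_modAll (SettingModel.isSlimGroup_piTemp_curveχ p))) :
    Prop15_i B (modelSystem C hC hS hl hp2 hpl hζ τ.modAll f hf τ.red_modAll h15 L hZ) :=
  prop15_i_modelSystem_of_facts_symm C hC hS hl hp2 hpl hζ τ f hf (SettingModel.isSlimGroup_piTemp_curveχ p)
    (SettingModel.isOpenMap_aug_modelχ p) h15 h15ii L hZ h218i h219iii (ThetaSetting.modelχ_isEtThOrigin p)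
    (SettingModel.hYcl_modelχ p) B hB

/-! ## Summary: Prop. 1.5 (i) (printed form) ∧ (ii), one residual binder list, at the record model -/

/-- **[IUTchII] Prop. 1.5 (i) (printed form) ∧ (ii) for the NATURAL projective system of model mono-theta
environments of `X̲̲` over `ℕ≥1` AT THE RECORD MODEL `modelχ p`**, modulo ONE residual binder list — Prop. 1.5
(ii), (iii) of [EtTh] §1, the cusp labels, [EtTh] Cor. 2.18 (i) at every chain level, `ThetaEnvTower.Cor219_iii` —
the four interface / origin binders of abc-iut-L2-t10's `prop15_modelSystem_of_origin` (temp-slimness of `Π^tp_X`,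
`IsOpenMap D.aug`, `IsEtThOrigin`, `hYcl`) being THEOREMS at `modelχ p`.
[claim: Mochizuki2012, status: disputed] (IUTchII §1 Prop 1.5, kurims p.29) [cite: MochizukiEtTh2009, Cor 2.19(ii) p.64] -/
theorem prop15_modelSystem_modelχ
    (h15 : Literature.AnabelianGeometry.EtaleTheta.ThetaSetting.Prop15iii E hC)
    (h15ii : Literature.AnabelianGeometry.EtaleTheta.ThetaSetting.Prop15ii E.toKummerData hC)
    (L : C.CuspLabels)
    (h218i : ∀ e : Es, (C.rigidData (τ.mod e) hC hS h15 L).Cor218_i)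
    (h219iii : (C.thetaEnvTower τ hC hS).Cor219_iii) :
    (modelSystem C hC hS hl hp2 hpl hζ τ.modAll f hf τ.red_modAll h15 L (fun M =>
      ModelCyclotomes.nonempty_lDeltaQuot_rigidData_mulEquiv_zHat C (τ.modAll M) hC hS h15 L
        (ThetaSetting.modelχ_isEtThOrigin p) (SettingModel.hYcl_modelχ p) hl.ne_zero)).transitionsAreIsos ∧
    ∀ (B : MonoThetaProjSystem (modelFamily C hC hS hl hp2 hpl hζ τ.modAll f hf)),
      B.IsMonoThetaCompatible
        (reductions C hC hS hl hp2 hpl hζ τ.modAll f hf τ.red_modAll (SettingModel.isSlimGroup_piTemp_curveχ p)) →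
      Prop15_i (modelSystem C hC hS hl hp2 hpl hζ τ.modAll f hf τ.red_modAll h15 L (fun M =>
        ModelCyclotomes.nonempty_lDeltaQuot_rigidData_mulEquiv_zHat C (τ.modAll M) hC hS h15 L
          (ThetaSetting.modelχ_isEtThOrigin p) (SettingModel.hYcl_modelχ p) hl.ne_zero)) B :=
  prop15_modelSystem_of_origin C hC hS hl hp2 hpl hζ τ f hf (SettingModel.isSlimGroup_piTemp_curveχ p)
    (SettingModel.isOpenMap_aug_modelχ p) h15 h15ii L h218i h219iii (ThetaSetting.modelχ_isEtThOrigin p)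
    (SettingModel.hYcl_modelχ p)

end EtaleLevels

end Literature.IUT.HodgeArakelov

end
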